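import Summits.Parity.BatemanHorn.Theorems.RoughValueTransportBalancedSemiprimeLayerQuadraticSieveSequence
import HarnessLib

/-!
# Quadratic sieve for the balanced-semiprime layer, 3/7: window sums and the remainder `R_d`

The line `smooth-modulus-twisted-hooley` of crux `BalancedSemiprimeLayer` (route
`RoughValueTransport`, item stmt-Parity-9469) bounds the relaxed sifted divisor family
`pairFamily f i δ c x` of a QUADRATIC coordinate `g = fᵢ = aX² + bX + c` of a Bateman–Horn system
`f` (window `m ∈ (x^{1−δ}, x^{1+δ}]`, `m ∣ g(n)`, `(m, B) = 1`, `B = |2a·disc g|`, every `fⱼ(n)`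
free of primes `< x^c`) by ONE `(k+1)`-dimensional upper-bound sieve: the pairs `(n, m)` are
booked at the value `F(n) = ∏ⱼ fⱼ(n)` and sifted by the primes `< z = x^c` (the tree's PROVED
Fundamental Lemma `SieveSequence.fundamental_lemma_explicit`); the main term comes from the window
sums of `ρ_g(m)/m` (the tree's PROVED `RhoLogSums.abs_rhoLogSum_sub_le`), the remainders ARE the
uniform Type-I information `UniformTypeI g` on dyadic blocks of `n`.  The proof is spread over
seven files `RoughValueTransportBalancedSemiprimeLayerQuadraticSieve<Part>.lean`, `<Part>` =
`Defs`, `Sequence`, `Remainder`, `Core`, `Bookkeeping`, `Height`, and the empty suffix (the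
registered stub `stub_quadraticSieve`).

This file: the window sums
`∑_{U<m≤V, e∣m, (m,qB)=1} ρ_G(m)/m = 𝔠·log(V/U)·g(e)·∏_{p∣q}(1−g(p))` up to
`τ(q)(2𝔠/U + 4K_V τ(eq)³/√U)` (Möbius over `q` and `RhoLogSums.abs_rhoLogSum_sub_le`), the
congruence sums of the pair sequence as a quadruple sum of block counts, and the remainder bound
`|R_d| ≤ τ(d)(J·d·E_T + yTot·τ(d)·(2𝔠/U + 4K_V τ(d)³/√U))` from a Type-I bound `E_T` on the blocks.
-/

noncomputable section

open Polynomial Filter Finset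
open Literature.NumberTheory.Sieve
open scoped ArithmeticFunction.Moebius NumberTheorySymbols

namespace Summit.Parity.BatemanHorn.Cruxes.BalancedSemiprimeLayer.SmoothModulusTwistedHooley

namespace QuadraticSieve

open Iwaniec1978 RhoLogSums PropertySTypeI

variable {a b c : ℤ}

/-! ### F. Window sums of `ρ_G(m)/m` with a level `e` and a coprimality condition `(m, qB) = 1` -/

section Window

variable {χ : DirichletCharacter ℂ (4 * (b ^ 2 - 4 * a * c).natAbs)}

/-- **The window sums feeding the main term.**  For `e·q` squarefree and `1 ≤ U ≤ V`:
`|∑_{U<m≤V, e∣m, (m, qB)=1} ρ_G(m)/m − 𝔠·log(V/U)·g(e)·∏_{p∣q}(1 − g(p))| ≤ τ(q)·(2𝔠/U + 4 K_V τ(eq)³/√U)`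
(`g = rhoDensity a b c Q₀`, `𝔠 = cMain χ Q₀`, `K_V = kWin χ Q₀ V`): Möbius inversion of the condition
`(m, q) = 1` (`RhoLogSums.sum_filter_coprime_eq_sum_moebius`), the tree's PROVED window asymptotics
`RhoLogSums.abs_rhoLogSum_sub_le` for each level `e·e'`, `e' ∣ q`, and
`∑_{e'∣q} μ(e') g(e') = ∏_{p∣q}(1 − g(p))`. [folklore] -/
theorem abs_windowSum_sub_le (ha : 0 < a) (hirr : Irreducible (quadPoly a b c))
    (hχ : ∀ n : ℕ, Odd n → χ n = (J(b ^ 2 - 4 * a * c | n) : ℂ))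
    [NeZero (4 * (b ^ 2 - 4 * a * c).natAbs)]
    {U V : ℕ} (hU : 1 ≤ U) (hUV : U ≤ V) {e q : ℕ} (hsq : Squarefree (e * q)) :
    |∑ m ∈ (Ioc U V).filter (fun m : ℕ => e ∣ m ∧ m.Coprime (q * badB a b c)),
          (rhoG a b c m : ℝ) / m -
        cMain χ (badQ a b c) * Real.log ((V : ℝ) / U) * rhoDensity a b c (badQ a b c) e *
          ∏ p ∈ q.primeFactors, (1 - rhoDensity a b c (badQ a b c) p)| ≤
      (#q.divisors : ℝ) * (2 * cMain χ (badQ a b c) / U +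
        4 * (kWin χ (badQ a b c) V * (#(e * q).divisors : ℝ) ^ 3) / Real.sqrt U) := by
  have hB : badB a b c ≠ 0 := badB_ne_zero ha hirr
  set Q₀ := badQ a b c with hQ₀
  set g := rhoDensity a b c Q₀ with hgdef
  set 𝔠 := cMain χ Q₀ with h𝔠def
  set L := Real.log ((V : ℝ) / U) with hL
  have he0 : e ≠ 0 := fun h => hsq.ne_zero (by rw [h, zero_mul])
  have hq0 : q ≠ 0 := fun h => hsq.ne_zero (by rw [h, mul_zero])
  have heq : e.Coprime q := (Nat.squarefree_mul_iff.mp hsq).1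
  have hqsq : Squarefree q := (Nat.squarefree_mul_iff.mp hsq).2.2
  have h𝔠 : 0 < 𝔠 := const_pos ha hirr hχ (squarefree_badQ a b c)
  have hV1 : 1 ≤ V := hU.trans hUV
  have hK0 : 0 ≤ kWin χ Q₀ V := kWin_nonneg χ Q₀ hV1
  set Err : ℝ := 2 * 𝔠 / U + 4 * (kWin χ Q₀ V * (#(e * q).divisors : ℝ) ^ 3) / Real.sqrt U
    with hErr
  have hErr0 : 0 ≤ Err := by positivity
  -- Step 1: Möbius inversion of `(m, q) = 1`
  set A := (Ioc U V).filter (fun m : ℕ => e ∣ m ∧ m.Coprime (badB a b c)) with hA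
  have hfilt : (Ioc U V).filter (fun m : ℕ => e ∣ m ∧ m.Coprime (q * badB a b c)) =
      A.filter (fun m : ℕ => m.Coprime q) := by
    rw [hA, Finset.filter_filter]
    refine Finset.filter_congr fun m _ => ?_
    rw [Nat.coprime_mul_iff_right]
    tauto
  rw [hfilt, sum_filter_coprime_eq_sum_moebius hq0 A (fun m => (rhoG a b c m : ℝ) / m)]
  -- Step 2: the inner sums are window sums over the multiples of `e e'` prime to `Q₀`
  have hinner : ∀ e' ∈ q.divisors, A.filter (e' ∣ ·) =
      (Ioc U V).filter (fun m : ℕ => e * e' ∣ m ∧ m.Coprime Q₀) := by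
    intro e' he'
    have hee' : e.Coprime e' := heq.coprime_dvd_right (Nat.dvd_of_mem_divisors he')
    rw [hA, Finset.filter_filter]
    refine Finset.filter_congr fun m _ => ?_
    rw [← coprime_badB_iff hB m]
    constructor
    · rintro ⟨⟨h1, h2⟩, h3⟩
      exact ⟨hee'.mul_dvd_of_dvd_of_dvd h1 h3, h2⟩
    · rintro ⟨h1, h2⟩
      exact ⟨⟨(dvd_mul_right e e').trans h1, h2⟩, (dvd_mul_left e' e).trans h1⟩
  have hbound : ∀ e' ∈ q.divisors,
      |∑ m ∈ A.filter (e' ∣ ·), (rhoG a b c m : ℝ) / m - 𝔠 * g (e * e') * L| ≤ Err := by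
    intro e' he'
    have he'q : e' ∣ q := Nat.dvd_of_mem_divisors he'
    have he'0 : e' ≠ 0 := ne_zero_of_dvd_ne_zero hq0 he'q
    have hdvd : e * e' ∣ e * q := mul_dvd_mul_left e he'q
    have hsq' : Squarefree (e * e') := hsq.squarefree_of_dvd hdvd
    rw [hinner e' he']
    by_cases hcop : (e * e').Coprime Q₀
    · have h : |∑ m ∈ (Ioc U V).filter (fun m : ℕ => e * e' ∣ m ∧ m.Coprime Q₀),
            (rhoG a b c m : ℝ) / m - 𝔠 * g (e * e') * L| ≤
          2 * |𝔠| / U + 4 * (kWin χ Q₀ V * (#(e * e').divisors : ℝ) ^ 3) / Real.sqrt U :=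
        abs_rhoLogSum_sub_le ha hirr hχ (badQ_ne_zero a b c) (two_dvd_badQ hB)
          (fun p hp h => prime_dvd_badQ_of_dvd_a hB hp h)
          (fun p hp h => prime_dvd_badQ_of_dvd_disc hB hp h)
          (fun p hp h k hk => rhoG_pow_eq_of_not_dvd_badQ hB hp h hk) hsq' hcop hU hUV (χ := χ)
      refine h.trans ?_
      have hτ : (#(e * e').divisors : ℝ) ≤ #(e * q).divisors := by
        exact_mod_cast Finset.card_le_card (Nat.divisors_subset_of_dvd hsq.ne_zero hdvd)
      rw [hErr, abs_of_pos h𝔠]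
      gcongr
    · have hempty : (Ioc U V).filter (fun m : ℕ => e * e' ∣ m ∧ m.Coprime Q₀) = ∅ :=
        Finset.filter_false_of_mem fun m _ h => hcop (h.2.coprime_dvd_left h.1)
      have hg0 : g (e * e') = 0 :=
        rhoDensity_eq_zero_of_not_coprime a b c (mul_ne_zero he0 he'0) hcop
      rw [hempty, Finset.sum_empty, hg0, mul_zero, zero_mul, sub_zero, abs_zero]
      exact hErr0
  -- Step 3: the main terms add up to `𝔠 L g(e) ∏_{p ∣ q} (1 − g(p))`
  have hmainId : ∑ e' ∈ q.divisors, (μ e' : ℝ) * (𝔠 * g (e * e') * L) =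
      𝔠 * L * g e * ∏ p ∈ q.primeFactors, (1 - g p) := by
    rw [ArithmeticFunction.IsMultiplicative.prodPrimeFactors_one_sub_of_squarefree _
      (isMultiplicative_rhoDensity a b c Q₀) hqsq, Finset.mul_sum]
    refine Finset.sum_congr rfl fun e' he' => ?_
    have hee' : e.Coprime e' := heq.coprime_dvd_right (Nat.dvd_of_mem_divisors he')
    rw [(isMultiplicative_rhoDensity a b c Q₀).map_mul_of_coprime hee']
    ring
  have hdecomp : ∑ e' ∈ q.divisors, (μ e' : ℝ) * ∑ m ∈ A.filter (e' ∣ ·), (rhoG a b c m : ℝ) / m -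
      𝔠 * L * g e * ∏ p ∈ q.primeFactors, (1 - g p) =
      ∑ e' ∈ q.divisors, (μ e' : ℝ) *
        (∑ m ∈ A.filter (e' ∣ ·), (rhoG a b c m : ℝ) / m - 𝔠 * g (e * e') * L) := by
    rw [← hmainId, ← Finset.sum_sub_distrib]
    exact Finset.sum_congr rfl fun _ _ => by ring
  rw [hdecomp]
  calc |∑ e' ∈ q.divisors, (μ e' : ℝ) *
          (∑ m ∈ A.filter (e' ∣ ·), (rhoG a b c m : ℝ) / m - 𝔠 * g (e * e') * L)|
      ≤ ∑ e' ∈ q.divisors, |(μ e' : ℝ) *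
          (∑ m ∈ A.filter (e' ∣ ·), (rhoG a b c m : ℝ) / m - 𝔠 * g (e * e') * L)| :=
        Finset.abs_sum_le_sum_abs _ _
    _ ≤ ∑ _e' ∈ q.divisors, Err := Finset.sum_le_sum fun e' he' => by
        have hμ : |(μ e' : ℝ)| ≤ 1 := by
          rw [← Int.cast_abs]; exact_mod_cast ArithmeticFunction.abs_moebius_le_one
        rw [abs_mul]
        calc |(μ e' : ℝ)| * |∑ m ∈ A.filter (e' ∣ ·), (rhoG a b c m : ℝ) / m - 𝔠 * g (e * e') * L|
            ≤ 1 * Err := mul_le_mul hμ (hbound e' he') (abs_nonneg _) zero_le_one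
          _ = Err := one_mul _
    _ = (#q.divisors : ℝ) * Err := by rw [Finset.sum_const, nsmul_eq_mul]

end Window

/-! ### G. The remainder `R_d = A_d − G(d)X` of the pair sequence -/

/-- `#rootSet F q = ρ_F(q)`. [folklore] -/
theorem card_rootSet (F : ℤ[X]) (q : ℕ) : #(rootSet F q) = polyRootCountMod ![F] q :=
  card_filter_dvd_eval_eq_polyRootCountMod F q

section Remainder

variable {χ : DirichletCharacter ℂ (4 * (b ^ 2 - 4 * a * c).natAbs)}

/-- **The congruence sum `A_d` of the pair sequence as a quadruple sum of block counts**: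
`A_d = ∑_{e∣d} ∑_{j<J} ∑_{r ∈ rootSet F (d/e)} ∑_{m ∈ modSet U V e (d/e) B} blockCount G Y j (d/e) r m`.
[folklore] -/
theorem congrSum_pairSeq_eq {G F : ℤ[X]} (hGF : G ∣ F) {U V Y J B : ℕ} (X : ℝ)
    (g : ArithmeticFunction ℝ) (hg : g.IsMultiplicative) {x : ℝ}
    (hx : ∀ n ∈ Ioc Y (2 ^ J * Y), 0 < F.eval (n : ℤ) ∧ ((F.eval (n : ℤ) : ℤ) : ℝ) ≤ x)
    {d : ℕ} (hd : Squarefree d) :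
    (pairSeq G F (Ioc Y (2 ^ J * Y)) ((Ioc U V).filter (fun m : ℕ => m.Coprime B)) X g hg).congrSum
        d x =
      ∑ e ∈ d.divisors, ∑ j ∈ range J, ∑ r ∈ rootSet F (d / e), ∑ m ∈ modSet U V e (d / e) B,
        (blockCount G Y j (d / e) r m : ℝ) := by
  rw [congrSum_pairSeq _ _ _ _ _ _ _ hx, sum_card_eq_sum_divisors hGF hd]
  refine Finset.sum_congr rfl fun e he => ?_
  have hed : e ∣ d := Nat.dvd_of_mem_divisors he
  have hq0 : 0 < d / e := Nat.div_pos (Nat.le_of_dvd (Nat.pos_of_ne_zero hd.ne_zero) hed)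
    (Nat.pos_of_mem_divisors he)
  have hper : ∀ m ∈ modSet U V e (d / e) B,
      (#((Ioc Y (2 ^ J * Y)).filter fun n : ℕ =>
        (m : ℤ) ∣ G.eval (n : ℤ) ∧ ((d / e : ℕ) : ℤ) ∣ F.eval (n : ℤ)) : ℝ) =
      ∑ j ∈ range J, ∑ r ∈ rootSet F (d / e), (blockCount G Y j (d / e) r m : ℝ) := by
    intro m _
    rw [card_filter_Ioc_eq_sum_range, Nat.cast_sum]
    refine Finset.sum_congr rfl fun j _ => ?_
    rw [card_filter_dvd_and_dvd_eq_sum G F _ m hq0, Nat.cast_sum]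
    rfl
  change ∑ m ∈ modSet U V e (d / e) B, _ = _
  rw [Finset.sum_congr rfl hper, Finset.sum_comm]
  refine Finset.sum_congr rfl fun j _ => ?_
  rw [Finset.sum_comm]

/-- **The remainder bound.**  With `X = 𝔠·log(V/U)·yTot Y J`, density `G = pairDensity`, the
Type-I hypothesis `HT` (every block, every modulus `q ≤ D` and level `ℓ ≤ D`, error `≤ E_T`) and a
squarefree `d ≤ D`:
`|R_d| ≤ τ(d)·(J·d·E_T + yTot·τ(d)·(2𝔠/U + 4 K_V τ(d)³/√U))`. [folklore] -/
theorem abs_remainder_pairSeq_le (ha : 0 < a) (hirr : Irreducible (quadPoly a b c))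
    (hχ : ∀ n : ℕ, Odd n → χ n = (J(b ^ 2 - 4 * a * c | n) : ℂ))
    [NeZero (4 * (b ^ 2 - 4 * a * c).natAbs)]
    {F : ℤ[X]} (hGF : quadPoly a b c ∣ F)
    {U V Y J : ℕ} (hU : 1 ≤ U) (hUV : U ≤ V)
    {x : ℝ} (hx : ∀ n ∈ Ioc Y (2 ^ J * Y), 0 < F.eval (n : ℤ) ∧ ((F.eval (n : ℤ) : ℤ) : ℝ) ≤ x)
    {Dlev ET : ℝ} (hET : 0 ≤ ET)
    (HT : ∀ j ∈ range J, ∀ q r : ℕ, 1 ≤ q → (q : ℝ) ≤ Dlev → ∀ ℓ : ℕ, 1 ≤ ℓ → (ℓ : ℝ) ≤ Dlev →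
      |∑ m ∈ modSet U V ℓ q (badB a b c),
          ((blockCount (quadPoly a b c) Y j q r m : ℝ) -
            ((2 ^ j * Y : ℕ) : ℝ) / q * (rhoG a b c m : ℝ) / m)| ≤ ET)
    {d : ℕ} (hd : Squarefree d) (hdD : (d : ℝ) ≤ Dlev) :
    |(pairSeq (quadPoly a b c) F (Ioc Y (2 ^ J * Y))
        ((Ioc U V).filter (fun m : ℕ => m.Coprime (badB a b c)))
        (cMain χ (badQ a b c) * Real.log ((V : ℝ) / U) * yTot Y J)
        (pairDensity a b c F) (isMultiplicative_pairDensity a b c F)).remainder d x| ≤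
      (#d.divisors : ℝ) * ((J : ℝ) * d * ET + yTot Y J * #d.divisors *
        (2 * cMain χ (badQ a b c) / U +
          4 * (kWin χ (badQ a b c) V * (#d.divisors : ℝ) ^ 3) / Real.sqrt U)) := by
  -- notation
  set G := quadPoly a b c with hGdef
  set B := badB a b c with hBdef
  set Q₀ := badQ a b c with hQ₀
  set g := rhoDensity a b c Q₀ with hgdef
  set 𝔠 := cMain χ Q₀ with h𝔠def
  set L := Real.log ((V : ℝ) / U) with hL
  set Err : ℝ := 2 * 𝔠 / U + 4 * (kWin χ Q₀ V * (#d.divisors : ℝ) ^ 3) / Real.sqrt U with hErr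
  set 𝒜 := pairSeq G F (Ioc Y (2 ^ J * Y)) ((Ioc U V).filter (fun m : ℕ => m.Coprime B))
    (𝔠 * L * yTot Y J) (pairDensity a b c F) (isMultiplicative_pairDensity a b c F) with h𝒜
  -- the window sums and the Type-I errors
  set S : ℕ → ℝ := fun e => ∑ m ∈ modSet U V e (d / e) B, (rhoG a b c m : ℝ) / m with hS
  set T : ℕ → ℕ → ℕ → ℝ := fun e j r =>
    ∑ m ∈ modSet U V e (d / e) B, (blockCount G Y j (d / e) r m : ℝ) -
      ((2 ^ j * Y : ℕ) : ℝ) / (d / e : ℕ) * S e with hT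
  have h𝔠 : 0 < 𝔠 := const_pos ha hirr hχ (squarefree_badQ a b c)
  have hV1 : 1 ≤ V := hU.trans hUV
  have hK0 : 0 ≤ kWin χ Q₀ V := kWin_nonneg χ Q₀ hV1
  have hErr0 : 0 ≤ Err := by positivity
  have hdpos : 0 < d := Nat.pos_of_ne_zero hd.ne_zero
  have hYt : 0 ≤ yTot Y J := yTot_nonneg Y J
  have hediv : ∀ e ∈ d.divisors, e ∣ d ∧ 0 < e ∧ 0 < d / e ∧ e * (d / e) = d := fun e he =>
    ⟨Nat.dvd_of_mem_divisors he, Nat.pos_of_mem_divisors he,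
      Nat.div_pos (Nat.le_of_dvd hdpos (Nat.dvd_of_mem_divisors he)) (Nat.pos_of_mem_divisors he),
      Nat.mul_div_cancel' (Nat.dvd_of_mem_divisors he)⟩
  -- (1) `A_d` as a quadruple sum, and the inner `m`-sum as main term + Type-I error
  have hA := congrSum_pairSeq_eq hGF (𝔠 * L * yTot Y J) (pairDensity a b c F)
    (isMultiplicative_pairDensity a b c F) hx hd (U := U) (V := V) (B := B)
  have hinner : ∀ e j r, ∑ m ∈ modSet U V e (d / e) B, (blockCount G Y j (d / e) r m : ℝ) =
      ((2 ^ j * Y : ℕ) : ℝ) / (d / e : ℕ) * S e + T e j r := fun e j r => by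
    simp only [hT]; ring
  have hTle : ∀ e ∈ d.divisors, ∀ j ∈ range J, ∀ r : ℕ, |T e j r| ≤ ET := by
    intro e he j hj r
    obtain ⟨hed, he0, hq0, -⟩ := hediv e he
    have hqD : ((d / e : ℕ) : ℝ) ≤ Dlev := le_trans (by exact_mod_cast Nat.div_le_self d e) hdD
    have heD : (e : ℝ) ≤ Dlev := le_trans (by exact_mod_cast Nat.le_of_dvd hdpos hed) hdD
    have h := HT j hj (d / e) r hq0 hqD e he0 heD
    have hTeq : T e j r = ∑ m ∈ modSet U V e (d / e) B,
        ((blockCount G Y j (d / e) r m : ℝ) -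
          ((2 ^ j * Y : ℕ) : ℝ) / (d / e : ℕ) * (rhoG a b c m : ℝ) / m) := by
      simp only [hT, hS, Finset.mul_sum, ← Finset.sum_sub_distrib]
      exact Finset.sum_congr rfl fun m _ => by ring
    rw [hTeq]
    exact h
  -- (2) the main terms: `∑_j ∑_r (2^jY/q) S(e) = ρ_F(q) (yTot/q) S(e)`
  have hmainSum : ∀ e ∈ d.divisors,
      ∑ j ∈ range J, ∑ r ∈ rootSet F (d / e), ((2 ^ j * Y : ℕ) : ℝ) / (d / e : ℕ) * S e =
        (polyRootCountMod ![F] (d / e) : ℝ) * (yTot Y J / (d / e : ℕ)) * S e := by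
    intro e _
    calc ∑ j ∈ range J, ∑ r ∈ rootSet F (d / e), ((2 ^ j * Y : ℕ) : ℝ) / (d / e : ℕ) * S e
        = ∑ j ∈ range J, (polyRootCountMod ![F] (d / e) : ℝ) *
            (((2 ^ j * Y : ℕ) : ℝ) / (d / e : ℕ) * S e) :=
          Finset.sum_congr rfl fun j _ => by
            rw [Finset.sum_const, nsmul_eq_mul, card_rootSet]
      _ = (polyRootCountMod ![F] (d / e) : ℝ) *
            ((∑ j ∈ range J, ((2 ^ j * Y : ℕ) : ℝ)) / (d / e : ℕ) * S e) := by
          rw [← Finset.mul_sum, Finset.sum_div, Finset.sum_mul]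
      _ = (polyRootCountMod ![F] (d / e) : ℝ) * (yTot Y J / (d / e : ℕ)) * S e := by
          rw [yTot]; ring
  -- (3) `G(d) X`
  have hGX : pairDensity a b c F d * (𝔠 * L * yTot Y J) =
      ∑ e ∈ d.divisors, (polyRootCountMod ![F] (d / e) : ℝ) / (d / e : ℕ) *
        (∏ p ∈ (d / e).primeFactors, (1 - g p)) * g e * (𝔠 * L * yTot Y J) := by
    rw [pairDensity_apply, Finset.sum_mul]
    refine Finset.sum_congr rfl fun e he => ?_
    rw [cofDensity_apply (hediv e he).2.2.1.ne']
  -- (4) the remainder, rearranged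
  have hrem : 𝒜.remainder d x =
      ∑ e ∈ d.divisors, (polyRootCountMod ![F] (d / e) : ℝ) * (yTot Y J / (d / e : ℕ)) *
          (S e - 𝔠 * L * g e * ∏ p ∈ (d / e).primeFactors, (1 - g p)) +
        ∑ e ∈ d.divisors, ∑ j ∈ range J, ∑ r ∈ rootSet F (d / e), T e j r := by
    rw [SieveSequence.remainder, h𝒜, hA]
    change _ - pairDensity a b c F d * (𝔠 * L * yTot Y J) = _
    rw [hGX, ← Finset.sum_add_distrib, ← Finset.sum_sub_distrib]
    refine Finset.sum_congr rfl fun e he => ?_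
    have h1 : ∑ j ∈ range J, ∑ r ∈ rootSet F (d / e), ∑ m ∈ modSet U V e (d / e) B,
          (blockCount G Y j (d / e) r m : ℝ) =
        (polyRootCountMod ![F] (d / e) : ℝ) * (yTot Y J / (d / e : ℕ)) * S e +
          ∑ j ∈ range J, ∑ r ∈ rootSet F (d / e), T e j r := by
      rw [← hmainSum e he, ← Finset.sum_add_distrib]
      refine Finset.sum_congr rfl fun j _ => ?_
      rw [← Finset.sum_add_distrib]
      exact Finset.sum_congr rfl fun r _ => hinner e j r
    rw [h1]
    ring
  -- (5) bounds for the two pieces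
  have hwin : ∀ e ∈ d.divisors,
      |(polyRootCountMod ![F] (d / e) : ℝ) * (yTot Y J / (d / e : ℕ)) *
          (S e - 𝔠 * L * g e * ∏ p ∈ (d / e).primeFactors, (1 - g p))| ≤
        yTot Y J * (#d.divisors * Err) := by
    intro e he
    obtain ⟨hed, he0, hq0, hmul⟩ := hediv e he
    have hq0' : (0 : ℝ) < ((d / e : ℕ) : ℝ) := by exact_mod_cast hq0
    have hsq : Squarefree (e * (d / e)) := by rw [hmul]; exact hd
    have hW := abs_windowSum_sub_le ha hirr hχ hU hUV hsq (χ := χ)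
    rw [hmul] at hW
    have hW' : |S e - 𝔠 * L * g e * ∏ p ∈ (d / e).primeFactors, (1 - g p)| ≤
        #(d / e).divisors * Err := by
      have e1 : 𝔠 * L * g e * ∏ p ∈ (d / e).primeFactors, (1 - g p) =
          cMain χ (badQ a b c) * Real.log ((V : ℝ) / U) * rhoDensity a b c (badQ a b c) e *
            ∏ p ∈ (d / e).primeFactors, (1 - rhoDensity a b c (badQ a b c) p) := rfl
      rw [e1]
      exact hW
    have hτ : (#(d / e).divisors : ℝ) ≤ #d.divisors := by
      exact_mod_cast Finset.card_le_card (Nat.divisors_subset_of_dvd hd.ne_zero (Nat.div_dvd_of_dvd hed))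
    have hρq : (polyRootCountMod ![F] (d / e) : ℝ) / (d / e : ℕ) ≤ 1 := by
      rw [div_le_one hq0']
      exact_mod_cast polyRootCountMod_le ![F] (d / e)
    have hρ0 : 0 ≤ (polyRootCountMod ![F] (d / e) : ℝ) * (yTot Y J / (d / e : ℕ)) := by positivity
    rw [abs_mul, abs_of_nonneg hρ0]
    calc (polyRootCountMod ![F] (d / e) : ℝ) * (yTot Y J / (d / e : ℕ)) *
          |S e - 𝔠 * L * g e * ∏ p ∈ (d / e).primeFactors, (1 - g p)|
        ≤ (1 * yTot Y J) * (#d.divisors * Err) := by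
          refine mul_le_mul ?_ (hW'.trans (mul_le_mul_of_nonneg_right hτ hErr0)) (abs_nonneg _)
            (by positivity)
          calc (polyRootCountMod ![F] (d / e) : ℝ) * (yTot Y J / (d / e : ℕ))
              = (polyRootCountMod ![F] (d / e) : ℝ) / (d / e : ℕ) * yTot Y J := by ring
            _ ≤ 1 * yTot Y J := mul_le_mul_of_nonneg_right hρq hYt
      _ = yTot Y J * (#d.divisors * Err) := by ring
  have hTsum : ∀ e ∈ d.divisors,
      |∑ j ∈ range J, ∑ r ∈ rootSet F (d / e), T e j r| ≤ (J : ℝ) * d * ET := by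
    intro e he
    obtain ⟨hed, he0, hq0, hmul⟩ := hediv e he
    have hρle : (#(rootSet F (d / e)) : ℝ) ≤ d := by
      rw [card_rootSet]
      exact_mod_cast (polyRootCountMod_le ![F] (d / e)).trans (Nat.div_le_self d e)
    calc |∑ j ∈ range J, ∑ r ∈ rootSet F (d / e), T e j r|
        ≤ ∑ j ∈ range J, |∑ r ∈ rootSet F (d / e), T e j r| := Finset.abs_sum_le_sum_abs _ _
      _ ≤ ∑ j ∈ range J, ∑ r ∈ rootSet F (d / e), |T e j r| :=
          Finset.sum_le_sum fun j _ => Finset.abs_sum_le_sum_abs _ _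
      _ ≤ ∑ j ∈ range J, ∑ _r ∈ rootSet F (d / e), ET :=
          Finset.sum_le_sum fun j hj => Finset.sum_le_sum fun r _ => hTle e he j hj r
      _ = (J : ℝ) * (#(rootSet F (d / e)) * ET) := by
          rw [Finset.sum_const, nsmul_eq_mul, Finset.sum_const, nsmul_eq_mul, Finset.card_range]
      _ ≤ (J : ℝ) * (d * ET) := by gcongr
      _ = (J : ℝ) * d * ET := by ring
  -- (6) assemble
  rw [hrem]
  calc |∑ e ∈ d.divisors, (polyRootCountMod ![F] (d / e) : ℝ) * (yTot Y J / (d / e : ℕ)) *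
            (S e - 𝔠 * L * g e * ∏ p ∈ (d / e).primeFactors, (1 - g p)) +
          ∑ e ∈ d.divisors, ∑ j ∈ range J, ∑ r ∈ rootSet F (d / e), T e j r|
      ≤ |∑ e ∈ d.divisors, (polyRootCountMod ![F] (d / e) : ℝ) * (yTot Y J / (d / e : ℕ)) *
            (S e - 𝔠 * L * g e * ∏ p ∈ (d / e).primeFactors, (1 - g p))| +
          |∑ e ∈ d.divisors, ∑ j ∈ range J, ∑ r ∈ rootSet F (d / e), T e j r| := abs_add_le _ _
    _ ≤ ∑ e ∈ d.divisors, |(polyRootCountMod ![F] (d / e) : ℝ) * (yTot Y J / (d / e : ℕ)) *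
            (S e - 𝔠 * L * g e * ∏ p ∈ (d / e).primeFactors, (1 - g p))| +
          ∑ e ∈ d.divisors, |∑ j ∈ range J, ∑ r ∈ rootSet F (d / e), T e j r| :=
        add_le_add (Finset.abs_sum_le_sum_abs _ _) (Finset.abs_sum_le_sum_abs _ _)
    _ ≤ ∑ _e ∈ d.divisors, yTot Y J * (#d.divisors * Err) + ∑ _e ∈ d.divisors, (J : ℝ) * d * ET :=
        add_le_add (Finset.sum_le_sum hwin) (Finset.sum_le_sum hTsum)
    _ = (#d.divisors : ℝ) * ((J : ℝ) * d * ET + yTot Y J * #d.divisors * Err) := by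
        rw [Finset.sum_const, Finset.sum_const, nsmul_eq_mul, nsmul_eq_mul]; ring

end Remainder

end QuadraticSieve

/-- **Anchor of part 3/7**: the registered sub-goal `stub_quadraticSieve_part3` of
`stub_quadraticSieve` (`ledger workitem stub-add`), through which this helper file lands
`--supports stmt-Parity-9469`:
the root classes of `F` modulo `q` are `ρ_F(q)` in number (the count behind the main term of
`R_d`). [folklore] -/
theorem stub_quadraticSieve_part3 :
    ∀ (F : ℤ[X]) (q : ℕ), #(QuadraticSieve.rootSet F q) = polyRootCountMod ![F] q :=
  fun F q => QuadraticSieve.card_rootSet F q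

end Summit.Parity.BatemanHorn.Cruxes.BalancedSemiprimeLayer.SmoothModulusTwistedHooley
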